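import Literature.Computability.AlgebraicComplexity.PencilFamily
import Literature.Computability.AlgebraicComplexity.MignonRessayreBound

/-!
# `UlrichPadded.OrbitCorankTwo` (stmt-ValiantsHypothesis-15032), line `SketchIdeator1`:
# stub S2 `orbitCorankTwo_padNonTight` — padded representations are non-tight

For `n ≥ 3`, an affine determinantal representation `A` of `per_n` of size `m₀` yields, for every
size `m > m₀`, an affine determinantal representation `B` of size `m` whose LINEAR part has all
submaximal minors in the ideal `(per_n)` — in fact they all vanish identically.

Proof.  Take `B = A ⊕ 1_{m - m₀}` (block diagonal, reindexed along
`Fin m₀ ⊕ Fin (m - m₀) ≃ Fin m`).  Its entries are those of `A`, `0` or `1` (affine) and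
`det B = det A = per_n` (`Matrix.det_fromBlocks_zero₂₁`).  The linear part of `B` is
`lin A ⊕ 0_{m - m₀}` (the degree-`1` component of the constants `0`, `1` is `0`), and the adjugate
of such a block matrix vanishes as soon as `det (lin A) = 0` (`adjugate_fromBlocks_zero₂₂_of_det_eq_zero`:
every cofactor has a zero padded row or a zero padded column, except the diagonal padded cofactor
when exactly one row is padded, which is `det (lin A)`).  Finally `det (lin A)` is the top
homogeneous component `hc_{m₀} (det A) = hc_{m₀} (per_n)`
(`homogeneousComponent_card_det_of_totalDegree_le_one`), which is `0` because `per_n` is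
homogeneous of degree `n ≠ m₀`: a size-`n` representation of `per_n` would contradict the
Mignon–Ressayre bound `n² ≤ 2 m₀` (`sq_le_two_mul_of_hasDetRepr_perPoly`) for `n ≥ 3`.
-/

noncomputable section

namespace Summit.ValiantsHypothesis.Theorems

open MvPolynomial Matrix
open Literature.Computability.AlgebraicComplexity

/-- **Linear algebra.** If `det L = 0` then the adjugate of the block-diagonal matrix
`L ⊕ 0_κ` with a NONEMPTY zero block vanishes: the cofactor `(i, j)` is the determinant of
`L ⊕ 0` with row `j` replaced by `e_i`; a padded row other than `j` stays zero, so only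
`j = inr q` with `κ = {q}` survives; then for `i = inl _` the padded column `inr q` vanishes, and
for `i = inr q` the updated matrix is `L ⊕ 1`, of determinant `det L = 0`. [folklore] -/
theorem adjugate_fromBlocks_zero₂₂_of_det_eq_zero {R : Type*} [CommRing R] {ι κ : Type*}
    [Fintype ι] [DecidableEq ι] [Fintype κ] [DecidableEq κ] [Nonempty κ]
    (L : Matrix ι ι R) (hL : L.det = 0) :
    (fromBlocks L 0 0 (0 : Matrix κ κ R)).adjugate = 0 := by
  ext i j
  rw [adjugate_apply, Matrix.zero_apply]
  -- a padded row other than the updated one stays zero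
  have hrow : ∀ p : κ, Sum.inr p ≠ j →
      ((fromBlocks L 0 0 (0 : Matrix κ κ R)).updateRow j (Pi.single i 1)).det = 0 := by
    intro p hp
    refine det_eq_zero_of_row_eq_zero (Sum.inr p) fun b => ?_
    rw [updateRow_ne hp]
    rcases b with b | b <;> simp
  rcases j with j | j
  · exact hrow (Classical.arbitrary κ) Sum.inr_ne_inl
  rcases i with i | i
  · -- the padded column `inr j` of the updated matrix vanishes
    refine det_eq_zero_of_column_eq_zero (Sum.inr j) fun a => ?_
    rw [updateRow_apply]
    split_ifs
    · simp
    · rcases a with a | a <;> simp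
  by_cases hij : i = j
  · rw [hij] at hrow ⊢
    by_cases hp : ∃ p : κ, p ≠ j
    · obtain ⟨p, hp⟩ := hp
      exact hrow p fun h => hp (Sum.inr_injective h)
    push Not at hp
    -- `κ = {j}`: the updated matrix is `L ⊕ 1`
    have h1 : (fromBlocks L 0 0 (0 : Matrix κ κ R)).updateRow (Sum.inr j)
        (Pi.single (Sum.inr j) 1) = fromBlocks L 0 0 1 := by
      ext a b
      rcases a with a | a
      · rw [updateRow_ne Sum.inl_ne_inr]
        rcases b with b | b <;> simp
      · rw [hp a, updateRow_self]
        rcases b with b | b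
        · simp
        · rw [hp b]
          simp
    rw [h1, det_fromBlocks_zero₂₁, det_one, mul_one, hL]
  · exact hrow i fun h => hij (Sum.inr_injective h)

/-- **Stub S2 `orbitCorankTwo_padNonTight`** (padding, line `SketchIdeator1` of
`UlrichPadded.OrbitCorankTwo`): an affine determinantal representation `A` of `per_n` (`n ≥ 3`) of
size `m₀` yields, for every `m > m₀`, an affine determinantal representation `B = A ⊕ 1` of size
`m` whose linear part `lin B = lin A ⊕ 0` has all submaximal minors in `(per_n)`: they vanish,
because `det (lin A) = hc_{m₀} (per_n) = 0` (`m₀ ≠ n` by the Mignon–Ressayre bound). [folklore] -/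
theorem orbitCorankTwo_padNonTight :
    ∀ n : ℕ, 3 ≤ n → ∀ (m₀ : ℕ) (A : Matrix (Fin m₀) (Fin m₀) (MvPolynomial (Fin n × Fin n) ℂ)),
      IsAffineDetRepr (perPoly (Fin n) ℂ) A → ∀ m : ℕ, m₀ < m →
      ∃ B : Matrix (Fin m) (Fin m) (MvPolynomial (Fin n × Fin n) ℂ),
        IsAffineDetRepr (perPoly (Fin n) ℂ) B ∧
        ∀ i j, (Matrix.of fun a b => MvPolynomial.homogeneousComponent 1 (B a b)).adjugate i j ∈
          Ideal.span {perPoly (Fin n) ℂ} := by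
  intro n hn m₀ A hA m hm
  obtain ⟨n, rfl⟩ : ∃ n', n = n' + 3 := ⟨n - 3, by omega⟩
  obtain ⟨c, rfl⟩ : ∃ c, m = m₀ + (c + 1) := ⟨m - m₀ - 1, by omega⟩
  obtain ⟨hdeg, hdet⟩ := hA
  -- the linear part of `A` is singular: `det (lin A) = hc_{m₀} (per_n) = 0` as `m₀ ≠ n`
  have hne : m₀ ≠ n + 3 := by
    intro h
    have hsq := sq_le_two_mul_of_hasDetRepr_perPoly (K := ℂ) (m := n) (M := m₀) ⟨A, hdeg, hdet⟩
    subst h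
    nlinarith [hsq]
  have hdetL : (Matrix.of fun a b => homogeneousComponent 1 (A a b)).det = 0 := by
    have hmap : (Matrix.of fun a b => homogeneousComponent 1 (A a b)) =
        A.map (homogeneousComponent 1) := rfl
    rw [hmap, ← homogeneousComponent_card_det_of_totalDegree_le_one A hdeg, hdet, Fintype.card_fin,
      homogeneousComponent_of_mem (perPoly_isHomogeneous (n := Fin (n + 3)) (k := ℂ)),
      Fintype.card_fin, if_neg hne]
  refine ⟨Matrix.reindex finSumFinEquiv finSumFinEquiv (Matrix.fromBlocks A 0 0 1), ⟨?_, ?_⟩, ?_⟩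
  · -- affine entries: those of `A`, `0` or `1`
    intro i j
    rw [Matrix.reindex_apply, Matrix.submatrix_apply]
    generalize finSumFinEquiv.symm i = a
    generalize finSumFinEquiv.symm j = b
    rcases a with a | a <;> rcases b with b | b
    · simpa using hdeg a b
    · simp
    · simp
    · simp only [Matrix.fromBlocks_apply₂₂, Matrix.one_apply]
      split_ifs <;> simp
  · -- `det (A ⊕ 1) = det A = per_n`
    rw [Matrix.det_reindex_self, Matrix.det_fromBlocks_zero₂₁, Matrix.det_one, mul_one, hdet]
  · -- the linear part is `lin A ⊕ 0`, whose adjugate vanishes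
    intro i j
    have hlin : (Matrix.of fun a b => homogeneousComponent 1
        ((Matrix.reindex finSumFinEquiv finSumFinEquiv (Matrix.fromBlocks A 0 0 1)) a b)) =
        Matrix.reindex finSumFinEquiv finSumFinEquiv
          (Matrix.fromBlocks (Matrix.of fun a b => homogeneousComponent 1 (A a b)) 0 0
            (0 : Matrix (Fin (c + 1)) (Fin (c + 1)) (MvPolynomial (Fin (n + 3) × Fin (n + 3)) ℂ))) := by
      refine Matrix.ext fun a b => ?_
      simp only [Matrix.of_apply, Matrix.reindex_apply, Matrix.submatrix_apply]
      generalize finSumFinEquiv.symm a = a'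
      generalize finSumFinEquiv.symm b = b'
      rcases a' with a' | a' <;> rcases b' with b' | b'
      · simp
      · simp
      · simp
      · simp only [Matrix.fromBlocks_apply₂₂, Matrix.one_apply, Matrix.zero_apply]
        split_ifs
        · exact homogeneousComponent_eq_zero 1 _ (by rw [totalDegree_one]; exact one_pos)
        · exact map_zero _
    rw [hlin, Matrix.adjugate_reindex, adjugate_fromBlocks_zero₂₂_of_det_eq_zero _ hdetL]
    simp

end Summit.ValiantsHypothesis.Theorems
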